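import Literature.MathematicalPhysics.QuantumFieldTheory.Balaban1983to89.B9ThmDCubeSideKernels
import Literature.MathematicalPhysics.QuantumFieldTheory.Balaban1983to89.B9ThmDLocDiffAlgebra
import Literature.MathematicalPhysics.QuantumFieldTheory.Balaban1983to89.B9Cor36SiteSandwichTransfer

/-!
# `Balaban1983to89.B9ThmDLocDiffMajorants` — THEOREM D FOR THE RECORD'S LETTERS, FILE D5: THE MEMBER-SIDE MAJORANTS — the three terms of file D1 transferred
# to the member's blocks (p33's site sandwich transfer) with the `M`-gap of file D4 folded into `e^{−ρM_h/4}`, composed with `η²G′(U)` ([4] (2.52)), and summed: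
# `conj b((η²η²)·M_{χ̃_□}(G′(U)² − O_□²)M_{1_{□⁺}}) ≺ κ·e^{−ρ_mM_h/4}·ℓ(a)⁴·e^{−rd}` on the site carrier (sub-row G-B9-LETTERS, GAPS G-B9-05, file D5)

T. Bałaban, *Propagators for lattice gauge theories in a background field*, Commun. Math. Phys. **99** (1985) 389–434 [`Balaban1985BackgroundPropagators`, "[B9]"];
[4] = T. Bałaban, *Propagators and renormalization transformations for lattice gauge theories. II*, Commun. Math. Phys. **96** (1984) 223–250 [`Balaban1984PropagatorsII`];
[2] of [B9] = T. Bałaban, *Regularity and decay of lattice Green's functions*, Commun. Math. Phys. **89** (1983) 571–597 [`Balaban1983RegularityDecay`].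

statement-level skeleton of published theorems with citation tags; proofs where landed; nothing here is a claim about the Yang–Mills mass gap

THE PRINT (held `paper:balaban1985-cmp99-background-propagators`, journal page = PDF page + 388).  p. 412 l. 1–9: *«Theorem D for the operators G′(U)², (G′_{□₀}(U))²
instead of G(Ω), G(Ω₀) … the operators may differ outside □̃₀, and the distance from □̃ to □̃₀ᶜ is at least M … ≦ O(1)e^{−δ₀M}(L^jη)^4 e^{−δ₀d(y,y′)}»*; [4] (2.52) p. 232,
(2.60)–(2.61) p. 234, (2.83) p. 237.  LABELLED DEVIATION (lead GO 15:21Z (b); files D1/D3/D4): no second random-walk expansion ([2] Sect. 5 (5.8) p. 594) — the commutator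
identity of D1, the (3.89) mechanism of D3 and the support gap of D4 replace it; the printed SHAPE `O(1)e^{−δ₀M}(L^jη)⁴e^{−δ₀d}` of the conclusion is kept.

WHAT THIS FILE PROVES (THEOREMS only; 0 `def`; 0 sorry).
* §1 `rs_mul`/`rs_sub`/`rs_one` (restriction of scalars is multiplicative), ★ `locDiff_three_terms` — `(η²η²)·(M_l(G′(U)² − O_□²)M_r)|_ℝ = T₁ + T₂ + T₃` in the sandwich shapes of
  p33's transfer lemma (file D1 §2 with `φ = χ = χ_□`, `K_χ·G′_□ = R_χ`, `M_1 = 1`).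
* §2 ★★ the three transfers `transfer_commStep`, `transfer_commStep_mul_G`, `transfer_G_oneSubSq_G` — cube-side kernels with the transition indicator ∕ gap weight (file D4)
  ⟹ member-side kernels `(M₂Σ‖b‖)²θ·e^{−ρM_h/4}·ℓ(a)^{0,2,4}·e^{−(ρ/2)d}` (the gap: `gap_dist_of_near_of_trans`; `d ≤ d_□`, `ℓ_□ ≤ ℓ` under coarsening).
* §3 ★★★ `hasMajorant_locDiff_site` — compositions with `η²G′(U) ≺ Aℓ²e^{−δ_Gd}` ([4] (2.52) with the scale transfer of `ℓ²`, twice for `T₁`, once for `T₂`), the row cut-off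
  `M_{χ̃_□}`, and the sum: `conj b((η²η²)·M_l(G′(U)² − O_□²)M_r) ≺ κ·ℓ(a)⁴·e^{−r₂d}` with `κ` explicit in the inputs.

HONEST SCOPE.  Lattice units; `𝔸` complete normed `ℂ`-algebra, real basis `b` (bound `M₂`); all letters' majorants, the gauge's bi-contractivity, (2.61) and the scale
transfers over `geo9K`/`geoCK` are HYPOTHESES (discharged at the (3.35) datum in file D6 from p33 7b-C/FILE 9, p21 F2/E2, M5.6 E1).  Count-neutral; nothing continuum,
nothing about OS axioms or the mass gap.  No `sorry`, no `axiom`, no `instance`, no `notation`.  NEW file.  Net new unproved facts: 0.  Seat `lit-balaban-p21` gen 35,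
2026-08-28; `--supports stmt-QuantumFields-19200`.
-/

noncomputable section

namespace Literature.MathematicalPhysics.QuantumFieldTheory.Balaban1983to89.B9ThmDLocDiffMajorants

open B6RandomWalk (HasMajorant BlockSupp hasMajorant_mono hasMajorant_add Triangle254 Ineq261 c1_nonneg)
open B9Thm34Ext (toB6)
open B9Ineq347 (ScaleTransfer)
open B6KLevelCensusIndexV1 (KIdx kGeo)
open B6Cover236MultiLevelBlocks (cubes)
open B6Cover236MultiLevelTorusBlocks (cubeIndT cubeIndT_zero_or_one cubeIndT_eq_zero_iff)
open B6Geom246MultiLevelBox (blkOf)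
open B6Ineq2142KLevelV1 (β)
open B6Partition118KLevelTorusCentral (QT QbigT QT_subset_QbigT)
open B9GeoNormsKLevelV1 (geo9K)
open B9Eq352DivFormLetters (conj conj_apply coordEquiv)
open B9Eq39Adjoint (R)
open B9Eq360DeltaPrimeACubeY (blkCubeY)
open B9CubeLettersOpsL0 (deltaPrimeACubeY GpCubeY)
open B9CubeLettersBondOpsL0 (BlkCubeY)
open B9CubeGeometryInputs (geoCK geoCK_eta geoCK_eta_pos geoCK_len_pos geoCK_dist_axioms)
open B9GeoLemma21KLevelV1 (one_le_Mh)
open B9Cor36CubeTwinsGeometry (bS one_le_bS eight_mul_bS_le_SC)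
open B9Cor36CubeCutoffs (SC NearC chiY one_le_SC abs_chiY_le_one)
open B9Cor36CutoffSecondDiff (nearH_of_nearC')
open B9Cor36SiteSandwichTransfer (hasMajorant_mul_of_rowLocal rowLocal_conj_of_local hasMajorant_conj_site_sandwich len_cube_le_len_member dist_member_le_dist_cube)
open B9Cor36GpCubeLocLetter (locLetterY)
open B9Thm37CubeCoverCommutators (cutMulY cutMulY_apply cutMulY_one KhY)
open B9Thm37CubeCoverCommutatorSizes (four_le_P')
open B9Thm39CinvAtCover (chiBigT)
open B9Thm39CinvUpperL (hasMajorant_mul_weighted hasMajorant_conj_mul_weighted)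
open B9ThmDCubePlateau (nearC_of_mem_QbigT chiBigT_site_mul_chiY chiY_mul_cubeIndT_site comm_cutMulY_chiY_deltaPrimeACubeY)
open B9ThmDCubeSideKernels (transInd nearInd gapW transInd_nonneg_le_one nearInd_nonneg_le_one nearInd_eq_one gap_dist_of_near_of_trans gapW_nonneg_le_one gapW_eq_of_near
  scaleTransfer_const)
open B9ThmDLocDiffAlgebra (cutMulY_GpY_sq_sub_locLetterY_sq_cutMulY)
open Node00 (SiteY BlkY IBondY CfgY GaugeY SiteParY toKT parSymY gaugeY gSiteY conjY UboxY GpY deltaPrimeAY parSymY_isGaugeLawS)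

variable {d ℓ : ℕ} {hd : 1 ≤ d + 1} {hL : Odd (ℓ + 1) ∧ 1 < ℓ + 1} {b₀ b₁ : ℝ}
variable {𝔸 : Type} [NormedRing 𝔸] [NormedAlgebra ℂ 𝔸] [CompleteSpace 𝔸]
variable {ι : Type} [Fintype ι]
variable (i : KIdx d ℓ hd hL b₀ b₁) (c : ↥(cubes (toKT i).D.toDomains))

/-! ## §1 The three terms of file D1 in the sandwich shapes, in `End_ℝ` -/

section Algebra

omit [CompleteSpace 𝔸] in
/-- restriction of scalars is multiplicative. [cite: Balaban1985BackgroundPropagators, (3.95) p.411, dictionary] -/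
theorem rs_mul (S T : Module.End ℂ (SiteY i → 𝔸)) : (S * T).restrictScalars ℝ = S.restrictScalars ℝ * T.restrictScalars ℝ := rfl

omit [CompleteSpace 𝔸] in
/-- restriction of scalars respects differences. [cite: Balaban1985BackgroundPropagators, (3.95) p.411, dictionary] -/
theorem rs_sub (S T : Module.End ℂ (SiteY i → 𝔸)) : (S - T).restrictScalars ℝ = S.restrictScalars ℝ - T.restrictScalars ℝ := rfl

omit [CompleteSpace 𝔸] in
/-- restriction of scalars of `1`. [cite: Balaban1985BackgroundPropagators, (3.95) p.411, dictionary] -/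
theorem rs_one : (1 : Module.End ℂ (SiteY i → 𝔸)).restrictScalars ℝ = 1 := rfl

omit [CompleteSpace 𝔸] in
/-- restriction of scalars of a composition. [cite: Balaban1985BackgroundPropagators, (3.95) p.411, dictionary] -/
theorem rs_comp (S T : Module.End ℂ (SiteY i → 𝔸)) : (S ∘ₗ T).restrictScalars ℝ = S.restrictScalars ℝ ∘ₗ T.restrictScalars ℝ := rfl

omit [CompleteSpace 𝔸] in
/-- restriction of scalars of the identity. [cite: Balaban1985BackgroundPropagators, (3.95) p.411, dictionary] -/
theorem rs_id : (LinearMap.id : Module.End ℂ (SiteY i → 𝔸)).restrictScalars ℝ = LinearMap.id := rfl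

/-- ★ **THE THREE TERMS OF FILE D1 IN `End_ℝ`, IN THE SANDWICH SHAPES**: with `O = G′(U; parSymY)`, `O_□ = M_χR(u)⁻¹G′_□(Ṽ)R(u)M_χ`, `R_χ = [M_χ, Δ′_{a,□}(Ṽ)]G′_□(Ṽ)`,
`η²G′`, `η²G′_□` the scaled letters, `Γ = R(u)`, real multipliers `χ_l, χ_r` with `χ_lχ = χ_l`, `χχ_r = χ_r`:
`(η²η²)·(M_l(O² − O_□²)M_r) = M_l(η²O)(η²O)(M_1Γ⁻¹R_χΓM_r) + M_l(η²O)(M_1Γ⁻¹(R_χ·η²G′_□)ΓM_r) + M_lΓ⁻¹(η²G′_□(1 − M_χ²)η²G′_□)ΓM_r`.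
[cite: Balaban1985BackgroundPropagators, (3.97) p.412, (3.88) p.409, Cor. 3.6 p.408; Balaban1983RegularityDecay, (5.8) p.594] -/
theorem locDiff_three_terms (g : GaugeY 𝔸 i) (U V : CfgY 𝔸 i) (χl χr : SiteY i → ℝ) (s : ℝ)
    (hU : IsUnit (deltaPrimeAY i (parSymY i) U)) (hunit : IsUnit (deltaPrimeACubeY i c (parSymY i) V))
    (hrows : deltaPrimeAY i (parSymY i) (gaugeY i g U) * cutMulY (chiY i c) = deltaPrimeACubeY i c (parSymY i) V * cutMulY (chiY i c))
    (hlχ : ∀ z, χl z * chiY i c z = χl z) (hrχ : ∀ z, chiY i c z * χr z = χr z) :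
    (s * s) • ((cutMulY (𝔸 := 𝔸) χl * (GpY i (parSymY i) U * GpY i (parSymY i) U -
        locLetterY i c (parSymY i) g (chiY i c) V * locLetterY i c (parSymY i) g (chiY i c) V) * cutMulY (𝔸 := 𝔸) χr).restrictScalars ℝ) =
      (cutMulY (𝔸 := 𝔸) χl).restrictScalars ℝ * ((s • (GpY i (parSymY i) U).restrictScalars ℝ) * (s • (GpY i (parSymY i) U).restrictScalars ℝ)) *
          ((cutMulY (𝔸 := 𝔸) fun _ : SiteY i => (1 : ℝ)).restrictScalars ℝ ∘ₗ (conjY (gSiteY i g)⁻¹).restrictScalars ℝ ∘ₗ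
            (((cutMulY (chiY i c) * deltaPrimeACubeY i c (parSymY i) V - deltaPrimeACubeY i c (parSymY i) V * cutMulY (chiY i c)) *
              GpCubeY i c (parSymY i) V).restrictScalars ℝ) ∘ₗ
            (conjY (gSiteY i g)).restrictScalars ℝ ∘ₗ (cutMulY (𝔸 := 𝔸) χr).restrictScalars ℝ) +
        (cutMulY (𝔸 := 𝔸) χl).restrictScalars ℝ * (s • (GpY i (parSymY i) U).restrictScalars ℝ) *
          ((cutMulY (𝔸 := 𝔸) fun _ : SiteY i => (1 : ℝ)).restrictScalars ℝ ∘ₗ (conjY (gSiteY i g)⁻¹).restrictScalars ℝ ∘ₗ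
            ((((cutMulY (chiY i c) * deltaPrimeACubeY i c (parSymY i) V - deltaPrimeACubeY i c (parSymY i) V * cutMulY (chiY i c)) *
              GpCubeY i c (parSymY i) V).restrictScalars ℝ) * (s • (GpCubeY i c (parSymY i) V).restrictScalars ℝ)) ∘ₗ
            (conjY (gSiteY i g)).restrictScalars ℝ ∘ₗ (cutMulY (𝔸 := 𝔸) χr).restrictScalars ℝ) +
        ((cutMulY (𝔸 := 𝔸) χl).restrictScalars ℝ ∘ₗ (conjY (gSiteY i g)⁻¹).restrictScalars ℝ ∘ₗ
          ((s • (GpCubeY i c (parSymY i) V).restrictScalars ℝ) *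
            ((1 - cutMulY (chiY i c) * cutMulY (chiY i c) : Module.End ℂ (SiteY i → 𝔸)).restrictScalars ℝ) *
            (s • (GpCubeY i c (parSymY i) V).restrictScalars ℝ)) ∘ₗ
          (conjY (gSiteY i g)).restrictScalars ℝ ∘ₗ (cutMulY (𝔸 := 𝔸) χr).restrictScalars ℝ) := by
  have hK := comm_cutMulY_chiY_deltaPrimeACubeY (𝔸 := 𝔸) i c V
  have hid := cutMulY_GpY_sq_sub_locLetterY_sq_cutMulY i c (parSymY_isGaugeLawS i) g U V (chiY i c) (chiY i c) χl χr hU hunit hrows hK hlχ hrχ hlχ hrχ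
  rw [hid, ← hK, cutMulY_one]
  simp only [Module.End.mul_eq_comp, Module.End.one_eq_id, rs_comp, rs_sub, rs_id, LinearMap.restrictScalars_add, LinearMap.comp_smul, LinearMap.smul_comp,
    LinearMap.comp_add, LinearMap.add_comp, LinearMap.comp_sub, LinearMap.sub_comp, smul_add, smul_sub, smul_smul, LinearMap.comp_assoc, LinearMap.id_comp,
    LinearMap.comp_id]

end Algebra

/-! ## §2 ★★ The three sandwich transfers with the `M`-gap folded into `e^{−ρM_h/4}` -/

section Transfer

variable (b : Module.Basis ι ℝ 𝔸) (ιB : BlkY i → IBondY i)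

/-- the right cut-off `1_{□⁺}` read at sites is `{0,1}`-valued, dominated by `1_N`, and supported near □. [cite: Balaban1985BackgroundPropagators, (3.95) p.411; Balaban1984PropagatorsII, p.239] -/
theorem cubeIndT_site_facts (z : SiteY i) :
    |cubeIndT i.D (one_le_Mh i) (four_le_P' i) c (blkOf i.D.toDomains z)| ≤ nearInd i c (blkCubeY i c z) ∧
    (cubeIndT i.D (one_le_Mh i) (four_le_P' i) c (blkOf i.D.toDomains z) ≠ 0 →
      NearC i c (2 * SC i c) z.1 ∧ B9CubeSequence408.NearH c z.1 ∧ nearInd i c (blkCubeY i c z) = 1) := by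
  have hS := one_le_SC i c
  by_cases ht : blkOf i.D.toDomains z ∈ QT i.D (one_le_Mh i) (four_le_P' i) c
  · have hnear : NearC i c (2 * SC i c) z.1 := nearC_of_mem_QbigT i c (QT_subset_QbigT (D := i.D) (one_le_Mh i) (four_le_P' i) c ht) rfl
    have h1 : cubeIndT i.D (one_le_Mh i) (four_le_P' i) c (blkOf i.D.toDomains z) = 1 := by unfold cubeIndT; rw [if_pos ht]
    rw [h1, nearInd_eq_one i c hnear]
    exact ⟨by norm_num, fun _ => ⟨hnear, nearH_of_nearC' i c (by linarith) hnear, rfl⟩⟩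
  · have h0 : cubeIndT i.D (one_le_Mh i) (four_le_P' i) c (blkOf i.D.toDomains z) = 0 := (cubeIndT_eq_zero_iff i.D _ _).2 ht
    rw [h0, abs_zero]
    exact ⟨(nearInd_nonneg_le_one i c _).1, fun h => absurd rfl h⟩

/-- the left cut-off `χ̃_□ = 1_{□̃}` read at sites is dominated by `1_N`. [cite: Balaban1985BackgroundPropagators, (3.95) p.411] -/
theorem chiBigT_site_le_nearInd (z : SiteY i) : |chiBigT i c (blkOf i.D.toDomains z)| ≤ nearInd i c (blkCubeY i c z) := by
  by_cases ht : blkOf i.D.toDomains z ∈ QbigT i.D (one_le_Mh i) (four_le_P' i) c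
  · have h1 : chiBigT i c (blkOf i.D.toDomains z) = 1 := by unfold chiBigT; rw [if_pos ht]
    rw [h1, nearInd_eq_one i c (nearC_of_mem_QbigT i c ht rfl)]; norm_num
  · have h0 : chiBigT i c (blkOf i.D.toDomains z) = 0 := by unfold chiBigT; rw [if_neg ht]
    rw [h0, abs_zero]; exact (nearInd_nonneg_le_one i c _).1

/-- the gap split `e^{−ρd_□(a,a₀)} ≤ e^{−ρM_h/4}·e^{−(ρ/2)d(ā,ā₀)}` for a transition block `a` and a near block `a₀` (`d ≤ d_□` under coarsening).
[cite: Balaban1985BackgroundPropagators, p.412 l.1–9; Balaban1984PropagatorsII, (2.46) p.231] -/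
theorem exp_gap_split (hι : ∀ s, β i.hN i.D i.hk (ιB s) = s) {ρ : ℝ} (hρ : 0 ≤ ρ) {x x₀ : SiteY i}
    (hx : transInd i c (blkCubeY i c x) = 1) (hx₀ : nearInd i c (blkCubeY i c x₀) = 1) :
    Real.exp (-(ρ * (geoCK i c).dist (blkCubeY i c x) (blkCubeY i c x₀))) ≤
      Real.exp (-(ρ * (((toKT i).Mh : ℝ) / 4))) * Real.exp (-(ρ / 2 * (geo9K i).dist (ιB (blkOf i.D.toDomains x)) (ιB (blkOf i.D.toDomains x₀)))) := by
  obtain ⟨-, -, -, hsymm⟩ := geoCK_dist_axioms i c (0 : ℝ) True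
  have hgap := gap_dist_of_near_of_trans i c hx₀ hx
  rw [hsymm] at hgap
  have hcmp := dist_member_le_dist_cube i c ιB hι x x₀
  rw [← Real.exp_add]
  exact Real.exp_le_exp.mpr (by nlinarith)

omit [CompleteSpace 𝔸] in
/-- ★★ **TRANSFER OF `R_χ`** (term `T₁`'s sandwich, `g₁ = 1`, `g₂ = 1_{□⁺}`): `conj b(R_χ) ≺ θ·1_T(a)·e^{−ρd_□}` over `geoCK` ⟹
`conj b(M_1Γ⁻¹R_χΓM_{1_{□⁺}}) ≺ (M₂Σ‖b‖)²θe^{−ρM_h/4}·e^{−(ρ/2)d}` over `geo9K`. [cite: Balaban1985BackgroundPropagators, p.412 l.1–9, Cor. 3.6 p.408, (3.89) p.409; Balaban1984PropagatorsII, (2.51)–(2.55) p.232] -/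
theorem transfer_commStep [CompleteSpace 𝔸] {M₂ : ℝ} (hM₂ : 0 ≤ M₂) (hrepr : ∀ (v : 𝔸) (j : ι), |b.repr v j| ≤ M₂ * ‖v‖)
    (hι : ∀ s, β i.hN i.D i.hk (ιB s) = s) (Rr : ℝ) (H : Prop) [Fintype (geo9K i).Site] (Rr' : ℝ) (Hp : Prop)
    (g : GaugeY 𝔸 i) (hγ : ∀ z a, ‖R (gSiteY i g z) a‖ ≤ ‖a‖ ∧ ‖R (gSiteY i g z)⁻¹ a‖ ≤ ‖a‖)
    (M : Module.End ℝ (SiteY i → 𝔸)) {θ ρ : ℝ} (hθ : 0 ≤ θ) (hρ : 0 ≤ ρ)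
    (hM : HasMajorant (g := toB6 (geoCK i c) Rr H) (fun p : SiteY i × ι => blkCubeY i c p.1) (conj b M)
      (fun a a' => θ * transInd i c a * Real.exp (-(ρ * (geoCK i c).dist a a')))) :
    HasMajorant (g := toB6 (geo9K i) Rr' Hp) (fun p : SiteY i × ι => ιB (blkOf i.D.toDomains p.1))
      (conj b ((cutMulY (𝔸 := 𝔸) fun _ : SiteY i => (1 : ℝ)).restrictScalars ℝ ∘ₗ (conjY (gSiteY i g)⁻¹).restrictScalars ℝ ∘ₗ M ∘ₗ
        (conjY (gSiteY i g)).restrictScalars ℝ ∘ₗ (cutMulY (𝔸 := 𝔸) fun z => cubeIndT i.D (one_le_Mh i) (four_le_P' i) c (blkOf i.D.toDomains z)).restrictScalars ℝ))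
      (fun a a' => (M₂ * ∑ j, ‖b j‖) ^ 2 * (θ * Real.exp (-(ρ * (((toKT i).Mh : ℝ) / 4))) * Real.exp (-(ρ / 2 * (geo9K i).dist a a')))) := by
  refine hasMajorant_mono (g := toB6 (geo9K i) Rr' Hp) _
    (hasMajorant_conj_site_sandwich i c b hM₂ hrepr (gSiteY i g) hγ (fun _ => (1 : ℝ)) _ (fun _ => (1 : ℝ)) (nearInd i c) (fun z => by simp)
      (fun z => (cubeIndT_site_facts i c z).1) (fun z hz => ((cubeIndT_site_facts i c z).2 hz).2.1) ιB hι Rr H Rr' Hp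
      (K := fun a a' => θ * Real.exp (-(ρ * (((toKT i).Mh : ℝ) / 4))) * Real.exp (-(ρ / 2 * (geo9K i).dist a a')))
      (fun a a' => by positivity) (fun x x₀ hx₀ => ?_) M hM)
    fun a a' => le_of_eq (by ring)
  have hN := ((cubeIndT_site_facts i c x₀).2 hx₀).2.2
  rw [hN, one_mul, mul_one]
  rcases eq_or_ne (transInd i c (blkCubeY i c x)) 1 with hT | hT
  · rw [hT, mul_one, mul_assoc]
    exact mul_le_mul_of_nonneg_left (exp_gap_split i c ιB hι hρ hT hN) hθ
  · have hT0 : transInd i c (blkCubeY i c x) = 0 := by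
      have h01 : transInd i c (blkCubeY i c x) = 0 ∨ transInd i c (blkCubeY i c x) = 1 := by unfold transInd; split_ifs <;> simp
      exact h01.resolve_right hT
    rw [hT0, mul_zero, zero_mul]; positivity

omit [CompleteSpace 𝔸] in
/-- ★★ **TRANSFER OF `R_χ·η²G′_□`** (term `T₂`'s sandwich): `conj b(R_χη²G′_□) ≺ θ·1_T(a)ℓ_□(a)²·e^{−ρd_□}` ⟹
`conj b(M_1Γ⁻¹(R_χη²G′_□)ΓM_{1_{□⁺}}) ≺ (M₂Σ‖b‖)²θe^{−ρM_h/4}·ℓ(a)²·e^{−(ρ/2)d}` (`ℓ_□ ≤ ℓ` under coarsening). [cite: Balaban1985BackgroundPropagators, p.412 l.1–9, Cor. 3.6 p.408; Balaban1984PropagatorsII, (2.51)–(2.55) p.232, (2.1) p.224] -/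
theorem transfer_commStep_mul_G [CompleteSpace 𝔸] {M₂ : ℝ} (hM₂ : 0 ≤ M₂) (hrepr : ∀ (v : 𝔸) (j : ι), |b.repr v j| ≤ M₂ * ‖v‖)
    (hι : ∀ s, β i.hN i.D i.hk (ιB s) = s) (Rr : ℝ) (H : Prop) [Fintype (geo9K i).Site] (Rr' : ℝ) (Hp : Prop)
    (g : GaugeY 𝔸 i) (hγ : ∀ z a, ‖R (gSiteY i g z) a‖ ≤ ‖a‖ ∧ ‖R (gSiteY i g z)⁻¹ a‖ ≤ ‖a‖)
    (M : Module.End ℝ (SiteY i → 𝔸)) {θ ρ : ℝ} (hθ : 0 ≤ θ) (hρ : 0 ≤ ρ)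
    (hM : HasMajorant (g := toB6 (geoCK i c) Rr H) (fun p : SiteY i × ι => blkCubeY i c p.1) (conj b M)
      (fun a a' => θ * (transInd i c a * (geoCK i c).len a ^ 2) * Real.exp (-(ρ * (geoCK i c).dist a a')))) :
    HasMajorant (g := toB6 (geo9K i) Rr' Hp) (fun p : SiteY i × ι => ιB (blkOf i.D.toDomains p.1))
      (conj b ((cutMulY (𝔸 := 𝔸) fun _ : SiteY i => (1 : ℝ)).restrictScalars ℝ ∘ₗ (conjY (gSiteY i g)⁻¹).restrictScalars ℝ ∘ₗ M ∘ₗ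
        (conjY (gSiteY i g)).restrictScalars ℝ ∘ₗ (cutMulY (𝔸 := 𝔸) fun z => cubeIndT i.D (one_le_Mh i) (four_le_P' i) c (blkOf i.D.toDomains z)).restrictScalars ℝ))
      (fun a a' => (M₂ * ∑ j, ‖b j‖) ^ 2 * (θ * Real.exp (-(ρ * (((toKT i).Mh : ℝ) / 4))) * (geo9K i).len a ^ 2 *
        Real.exp (-(ρ / 2 * (geo9K i).dist a a')))) := by
  have hl9 : ∀ a, 0 ≤ (geo9K i).len a := fun a => (B6KLevelCensusIndexV1.len_pos i a).le
  refine hasMajorant_mono (g := toB6 (geo9K i) Rr' Hp) _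
    (hasMajorant_conj_site_sandwich i c b hM₂ hrepr (gSiteY i g) hγ (fun _ => (1 : ℝ)) _ (fun _ => (1 : ℝ)) (nearInd i c) (fun z => by simp)
      (fun z => (cubeIndT_site_facts i c z).1) (fun z hz => ((cubeIndT_site_facts i c z).2 hz).2.1) ιB hι Rr H Rr' Hp
      (K := fun a a' => θ * Real.exp (-(ρ * (((toKT i).Mh : ℝ) / 4))) * (geo9K i).len a ^ 2 * Real.exp (-(ρ / 2 * (geo9K i).dist a a')))
      (fun a a' => mul_nonneg (mul_nonneg (mul_nonneg hθ (Real.exp_nonneg _)) (pow_nonneg (hl9 a) 2)) (Real.exp_nonneg _)) (fun x x₀ hx₀ => ?_) M hM)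
    fun a a' => le_of_eq (by ring)
  have hN := ((cubeIndT_site_facts i c x₀).2 hx₀).2.2
  have hlen := len_cube_le_len_member i c ιB hι x
  have hlen0 : 0 ≤ (geoCK i c).len (blkCubeY i c x) := (geoCK_len_pos i c _).le
  have hl9x := hl9 (ιB (blkOf i.D.toDomains x))
  rw [hN, one_mul, mul_one]
  rcases eq_or_ne (transInd i c (blkCubeY i c x)) 1 with hT | hT
  · rw [hT, one_mul]
    have h1 := exp_gap_split i c ιB hι hρ hT hN
    have hsq : (geoCK i c).len (blkCubeY i c x) ^ 2 ≤ (geo9K i).len (ιB (blkOf i.D.toDomains x)) ^ 2 := pow_le_pow_left₀ hlen0 hlen 2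
    calc θ * (geoCK i c).len (blkCubeY i c x) ^ 2 * Real.exp (-(ρ * (geoCK i c).dist (blkCubeY i c x) (blkCubeY i c x₀)))
        ≤ θ * (geo9K i).len (ιB (blkOf i.D.toDomains x)) ^ 2 *
            (Real.exp (-(ρ * (((toKT i).Mh : ℝ) / 4))) * Real.exp (-(ρ / 2 * (geo9K i).dist (ιB (blkOf i.D.toDomains x)) (ιB (blkOf i.D.toDomains x₀))))) :=
          mul_le_mul (mul_le_mul_of_nonneg_left hsq hθ) h1 (Real.exp_nonneg _) (mul_nonneg hθ (pow_nonneg hl9x 2))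
      _ = _ := by ring
  · have hT0 : transInd i c (blkCubeY i c x) = 0 := by
      have h01 : transInd i c (blkCubeY i c x) = 0 ∨ transInd i c (blkCubeY i c x) = 1 := by unfold transInd; split_ifs <;> simp
      exact h01.resolve_right hT
    rw [hT0, zero_mul, mul_zero, zero_mul]
    exact mul_nonneg (mul_nonneg (mul_nonneg hθ (Real.exp_nonneg _)) (pow_nonneg hl9x 2)) (Real.exp_nonneg _)

omit [CompleteSpace 𝔸] in
/-- ★★ **TRANSFER OF `η²G′_□(1 − M_χ²)η²G′_□`** (term `T₃`, `g₁ = χ̃_□`, `g₂ = 1_{□⁺}`): `≺ θ·ℓ_□²Ψ_σ(a)ℓ_□²·e^{−ρd_□}` ⟹ `≺ (M₂Σ‖b‖)²θe^{−σM_h/2}·ℓ(a)⁴·e^{−ρd}` — the row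
cut-off `χ̃_□` forces the row block near □, where `Ψ_σ = e^{−σM_h/2}`. [cite: Balaban1985BackgroundPropagators, p.412 l.1–9, (3.95) p.411, Cor. 3.6 p.408; Balaban1984PropagatorsII, (2.51)–(2.55) p.232] -/
theorem transfer_G_oneSubSq_G [CompleteSpace 𝔸] {M₂ : ℝ} (hM₂ : 0 ≤ M₂) (hrepr : ∀ (v : 𝔸) (j : ι), |b.repr v j| ≤ M₂ * ‖v‖)
    (hι : ∀ s, β i.hN i.D i.hk (ιB s) = s) (Rr : ℝ) (H : Prop) [Fintype (geo9K i).Site] (Rr' : ℝ) (Hp : Prop)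
    (g : GaugeY 𝔸 i) (hγ : ∀ z a, ‖R (gSiteY i g z) a‖ ≤ ‖a‖ ∧ ‖R (gSiteY i g z)⁻¹ a‖ ≤ ‖a‖)
    (M : Module.End ℝ (SiteY i → 𝔸)) {θ ρ σ : ℝ} (hθ : 0 ≤ θ) (hρ : 0 ≤ ρ)
    (hM : HasMajorant (g := toB6 (geoCK i c) Rr H) (fun p : SiteY i × ι => blkCubeY i c p.1) (conj b M)
      (fun a a' => θ * ((geoCK i c).len a ^ 2 * gapW i c σ a * (geoCK i c).len a ^ 2) * Real.exp (-(ρ * (geoCK i c).dist a a')))) :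
    HasMajorant (g := toB6 (geo9K i) Rr' Hp) (fun p : SiteY i × ι => ιB (blkOf i.D.toDomains p.1))
      (conj b ((cutMulY (𝔸 := 𝔸) fun z => chiBigT i c (blkOf i.D.toDomains z)).restrictScalars ℝ ∘ₗ (conjY (gSiteY i g)⁻¹).restrictScalars ℝ ∘ₗ M ∘ₗ
        (conjY (gSiteY i g)).restrictScalars ℝ ∘ₗ (cutMulY (𝔸 := 𝔸) fun z => cubeIndT i.D (one_le_Mh i) (four_le_P' i) c (blkOf i.D.toDomains z)).restrictScalars ℝ))
      (fun a a' => (M₂ * ∑ j, ‖b j‖) ^ 2 * (θ * Real.exp (-(σ * (((toKT i).Mh : ℝ) / 2))) * (geo9K i).len a ^ 4 *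
        Real.exp (-(ρ * (geo9K i).dist a a')))) := by
  obtain ⟨hdnn, -, -, -⟩ := geoCK_dist_axioms i c (0 : ℝ) True
  have hl9 : ∀ a, 0 ≤ (geo9K i).len a := fun a => (B6KLevelCensusIndexV1.len_pos i a).le
  refine hasMajorant_mono (g := toB6 (geo9K i) Rr' Hp) _
    (hasMajorant_conj_site_sandwich i c b hM₂ hrepr (gSiteY i g) hγ _ _ (nearInd i c) (nearInd i c) (chiBigT_site_le_nearInd i c)
      (fun z => (cubeIndT_site_facts i c z).1) (fun z hz => ((cubeIndT_site_facts i c z).2 hz).2.1) ιB hι Rr H Rr' Hp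
      (K := fun a a' => θ * Real.exp (-(σ * (((toKT i).Mh : ℝ) / 2))) * (geo9K i).len a ^ 4 * Real.exp (-(ρ * (geo9K i).dist a a')))
      (fun a a' => mul_nonneg (mul_nonneg (mul_nonneg hθ (Real.exp_nonneg _)) (pow_nonneg (hl9 a) 4)) (Real.exp_nonneg _)) (fun x x₀ hx₀ => ?_) M hM)
    fun a a' => le_of_eq (by ring)
  have hN₀ := ((cubeIndT_site_facts i c x₀).2 hx₀).2.2
  have hlen := len_cube_le_len_member i c ιB hι x
  have hlen0 : 0 ≤ (geoCK i c).len (blkCubeY i c x) := (geoCK_len_pos i c _).le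
  have hl9x := hl9 (ιB (blkOf i.D.toDomains x))
  rw [hN₀, mul_one]
  rcases eq_or_ne (nearInd i c (blkCubeY i c x)) 1 with hN | hN
  · -- the row block is near □: `Ψ_σ = e^{−σM_h/2}`, `ℓ_□⁴ ≤ ℓ⁴`, `d ≤ d_□`
    have hΨ : gapW i c σ (blkCubeY i c x) = Real.exp (-(σ * (((toKT i).Mh : ℝ) / 2))) := by unfold gapW; rw [if_pos hN]
    have h4 : (geoCK i c).len (blkCubeY i c x) ^ 2 * (geoCK i c).len (blkCubeY i c x) ^ 2 ≤ (geo9K i).len (ιB (blkOf i.D.toDomains x)) ^ 4 := by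
      have hsq : (geoCK i c).len (blkCubeY i c x) ^ 2 ≤ (geo9K i).len (ιB (blkOf i.D.toDomains x)) ^ 2 := pow_le_pow_left₀ hlen0 hlen 2
      nlinarith [sq_nonneg ((geoCK i c).len (blkCubeY i c x))]
    have hexp : Real.exp (-(ρ * (geoCK i c).dist (blkCubeY i c x) (blkCubeY i c x₀))) ≤
        Real.exp (-(ρ * (geo9K i).dist (ιB (blkOf i.D.toDomains x)) (ιB (blkOf i.D.toDomains x₀)))) :=
      Real.exp_le_exp.mpr (by nlinarith [dist_member_le_dist_cube i c ιB hι x x₀])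
    rw [hN, hΨ, one_mul]
    calc θ * ((geoCK i c).len (blkCubeY i c x) ^ 2 * Real.exp (-(σ * (((toKT i).Mh : ℝ) / 2))) * (geoCK i c).len (blkCubeY i c x) ^ 2) *
          Real.exp (-(ρ * (geoCK i c).dist (blkCubeY i c x) (blkCubeY i c x₀)))
        = θ * Real.exp (-(σ * (((toKT i).Mh : ℝ) / 2))) * ((geoCK i c).len (blkCubeY i c x) ^ 2 * (geoCK i c).len (blkCubeY i c x) ^ 2) *
          Real.exp (-(ρ * (geoCK i c).dist (blkCubeY i c x) (blkCubeY i c x₀))) := by ring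
      _ ≤ θ * Real.exp (-(σ * (((toKT i).Mh : ℝ) / 2))) * (geo9K i).len (ιB (blkOf i.D.toDomains x)) ^ 4 *
          Real.exp (-(ρ * (geo9K i).dist (ιB (blkOf i.D.toDomains x)) (ιB (blkOf i.D.toDomains x₀)))) :=
          mul_le_mul (mul_le_mul_of_nonneg_left h4 (mul_nonneg hθ (Real.exp_nonneg _))) hexp (Real.exp_nonneg _)
            (mul_nonneg (mul_nonneg hθ (Real.exp_nonneg _)) (pow_nonneg hl9x 4))
  · have hN0 : nearInd i c (blkCubeY i c x) = 0 := by
      have h01 : nearInd i c (blkCubeY i c x) = 0 ∨ nearInd i c (blkCubeY i c x) = 1 := by unfold nearInd; split_ifs <;> simp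
      exact h01.resolve_right hN
    rw [hN0, zero_mul]
    exact mul_nonneg (mul_nonneg (mul_nonneg hθ (Real.exp_nonneg _)) (pow_nonneg hl9x 4)) (Real.exp_nonneg _)

end Transfer

/-! ## §3 ★★★ Compositions with `η²G′(U)` and the sum: the site-level THEOREM D majorant -/

section Compose

variable (b : Module.Basis ι ℝ 𝔸) (ιB : BlkY i → IBondY i)

/-- rate weakening of a decay factor. [cite: Balaban1984PropagatorsII, (2.46) p.231, bookkeeping] -/
theorem exp_rate_mono {r r' x : ℝ} (hr : r' ≤ r) (hx : 0 ≤ x) : Real.exp (-(r * x)) ≤ Real.exp (-(r' * x)) :=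
  Real.exp_le_exp.mpr (by nlinarith)

omit [CompleteSpace 𝔸] in
/-- a real multiplier with `|χ_l| ≤ 1` is row-local with coefficient `M₂Σ‖b‖` after coordinates. [cite: Balaban1984PropagatorsII, (2.52) p.232 («a block-diagonal factor»)] -/
theorem rowLocal_cutMulY {M₂ : ℝ} (hM₂ : 0 ≤ M₂) (hrepr : ∀ (v : 𝔸) (j : ι), |b.repr v j| ≤ M₂ * ‖v‖) (χl : SiteY i → ℝ) (hχl : ∀ z, |χl z| ≤ 1) :
    ∀ (w : SiteY i × ι → ℝ) (p : SiteY i × ι) (M : ℝ), (∀ p' : SiteY i × ι, ιB (blkOf i.D.toDomains p'.1) = ιB (blkOf i.D.toDomains p.1) → |w p'| ≤ M) →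
      |conj b ((cutMulY (𝔸 := 𝔸) χl).restrictScalars ℝ) w p| ≤ (fun _ : IBondY i => (1 : ℝ)) (ιB (blkOf i.D.toDomains p.1)) * (M₂ * ∑ j, ‖b j‖) * M :=
  rowLocal_conj_of_local b (fun z : SiteY i => ιB (blkOf i.D.toDomains z)) (fun _ => (1 : ℝ)) hM₂ hrepr _ fun f x Bf hBf => by
    rw [LinearMap.restrictScalars_apply, cutMulY_apply, B9Thm37CubeCoverCommutatorSizes.norm_ofReal_smul]
    exact mul_le_mul (hχl x) (hBf x rfl) (norm_nonneg _) zero_le_one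

omit [CompleteSpace 𝔸] in
/-- ★★★ **THE SITE-LEVEL THEOREM D MAJORANT FROM THE THREE TRANSFERRED KERNELS AND `η²G′(U) ≺ Aℓ²e^{−rd}`** ([4] (2.52) with the scale transfer of `ℓ²`; the row
cut-off `M_{χ_l}`, `|χ_l| ≤ 1`): `conj b((ss)·M_{χ_l}(G′(U)² − O_□²)M_{χ_r}) ≺ κ·ℓ(a)⁴·e^{−r₂d}`, `r₁ = (1−α′)(1−α_st)r`, `r₂ = (1−α′)(1−α_st)r₁`,
`κ = M₂Σ‖b‖·(A²C_Gc₁(r)c₁(r₁)·κ₁ + AC_Gc₁(r)·κ₂) + κ₃` — print's «O(1)e^{−δ₀M}(L^jη)⁴e^{−δ₀d}» once the `κ_k` carry `e^{−ρM_h/4}` (§2).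
[cite: Balaban1985BackgroundPropagators, p.412 l.1–9, (3.97) p.412; Balaban1984PropagatorsII, (2.83) p.237, (2.52) p.232, (2.60)–(2.61) p.234] -/
theorem hasMajorant_locDiff_site [CompleteSpace 𝔸] {M₂ : ℝ} (hM₂ : 0 ≤ M₂) (hrepr : ∀ (v : 𝔸) (j : ι), |b.repr v j| ≤ M₂ * ‖v‖)
    [Fintype (geo9K i).Site] (Rr' : ℝ) (Hp : Prop) (g : GaugeY 𝔸 i) (U V : CfgY 𝔸 i) (χl χr : SiteY i → ℝ) (hχl : ∀ z, |χl z| ≤ 1) (s : ℝ)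
    (hU : IsUnit (deltaPrimeAY i (parSymY i) U)) (hunit : IsUnit (deltaPrimeACubeY i c (parSymY i) V))
    (hrows : deltaPrimeAY i (parSymY i) (gaugeY i g U) * cutMulY (chiY i c) = deltaPrimeACubeY i c (parSymY i) V * cutMulY (chiY i c))
    (hlχ : ∀ z, χl z * chiY i c z = χl z) (hrχ : ∀ z, chiY i c z * χr z = χr z)
    {A r αst α' CG κ₁ κ₂ κ₃ : ℝ} (d₁ d₂ : ℕ) (hA : 0 ≤ A) (hCG : 0 ≤ CG) (hκ₁ : 0 ≤ κ₁) (hκ₂ : 0 ≤ κ₂) (hκ₃ : 0 ≤ κ₃)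
    (hr0 : 0 ≤ r) (hαst0 : 0 ≤ αst) (hαst1 : αst ≤ 1) (hα'0 : 0 ≤ α') (hα'1 : α' ≤ 1)
    (htri : Triangle254 (toB6 (geo9K i) Rr' Hp)) (hdnn : ∀ a a' : (geo9K i).Site, 0 ≤ (geo9K i).dist a a')
    (hST : ScaleTransfer (geo9K i) r αst CG (fun a => (geo9K i).len a ^ 2))
    (h261a : Ineq261 d₁ (toB6 (geo9K i) Rr' Hp) ((1 - αst) * r) α')
    (h261b : Ineq261 d₂ (toB6 (geo9K i) Rr' Hp) ((1 - αst) * ((1 - α') * ((1 - αst) * r))) α')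
    (hO : HasMajorant (g := toB6 (geo9K i) Rr' Hp) (fun p : SiteY i × ι => ιB (blkOf i.D.toDomains p.1))
      (conj b (s • (GpY i (parSymY i) U).restrictScalars ℝ)) (fun a a' => A * (geo9K i).len a ^ 2 * Real.exp (-(r * (geo9K i).dist a a'))))
    (hS₁ : HasMajorant (g := toB6 (geo9K i) Rr' Hp) (fun p : SiteY i × ι => ιB (blkOf i.D.toDomains p.1))
      (conj b ((cutMulY (𝔸 := 𝔸) fun _ : SiteY i => (1 : ℝ)).restrictScalars ℝ ∘ₗ (conjY (gSiteY i g)⁻¹).restrictScalars ℝ ∘ₗ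
        (((cutMulY (chiY i c) * deltaPrimeACubeY i c (parSymY i) V - deltaPrimeACubeY i c (parSymY i) V * cutMulY (chiY i c)) *
          GpCubeY i c (parSymY i) V).restrictScalars ℝ) ∘ₗ
        (conjY (gSiteY i g)).restrictScalars ℝ ∘ₗ (cutMulY (𝔸 := 𝔸) χr).restrictScalars ℝ))
      (fun a a' => κ₁ * Real.exp (-(r * (geo9K i).dist a a'))))
    (hS₂ : HasMajorant (g := toB6 (geo9K i) Rr' Hp) (fun p : SiteY i × ι => ιB (blkOf i.D.toDomains p.1))
      (conj b ((cutMulY (𝔸 := 𝔸) fun _ : SiteY i => (1 : ℝ)).restrictScalars ℝ ∘ₗ (conjY (gSiteY i g)⁻¹).restrictScalars ℝ ∘ₗ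
        ((((cutMulY (chiY i c) * deltaPrimeACubeY i c (parSymY i) V - deltaPrimeACubeY i c (parSymY i) V * cutMulY (chiY i c)) *
          GpCubeY i c (parSymY i) V).restrictScalars ℝ) * (s • (GpCubeY i c (parSymY i) V).restrictScalars ℝ)) ∘ₗ
        (conjY (gSiteY i g)).restrictScalars ℝ ∘ₗ (cutMulY (𝔸 := 𝔸) χr).restrictScalars ℝ))
      (fun a a' => κ₂ * (geo9K i).len a ^ 2 * Real.exp (-(r * (geo9K i).dist a a'))))
    (hS₃ : HasMajorant (g := toB6 (geo9K i) Rr' Hp) (fun p : SiteY i × ι => ιB (blkOf i.D.toDomains p.1))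
      (conj b ((cutMulY (𝔸 := 𝔸) χl).restrictScalars ℝ ∘ₗ (conjY (gSiteY i g)⁻¹).restrictScalars ℝ ∘ₗ
        ((s • (GpCubeY i c (parSymY i) V).restrictScalars ℝ) *
          ((1 - cutMulY (chiY i c) * cutMulY (chiY i c) : Module.End ℂ (SiteY i → 𝔸)).restrictScalars ℝ) *
          (s • (GpCubeY i c (parSymY i) V).restrictScalars ℝ)) ∘ₗ
        (conjY (gSiteY i g)).restrictScalars ℝ ∘ₗ (cutMulY (𝔸 := 𝔸) χr).restrictScalars ℝ))
      (fun a a' => κ₃ * (geo9K i).len a ^ 4 * Real.exp (-(r * (geo9K i).dist a a')))) :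
    HasMajorant (g := toB6 (geo9K i) Rr' Hp) (fun p : SiteY i × ι => ιB (blkOf i.D.toDomains p.1))
      (conj b ((s * s) • ((cutMulY (𝔸 := 𝔸) χl * (GpY i (parSymY i) U * GpY i (parSymY i) U -
        locLetterY i c (parSymY i) g (chiY i c) V * locLetterY i c (parSymY i) g (chiY i c) V) * cutMulY (𝔸 := 𝔸) χr).restrictScalars ℝ)))
      (fun a a' => ((M₂ * ∑ j, ‖b j‖) * (A * A * CG * B6.c1 d₁ ((1 - αst) * r) α' * κ₁ * 1 * B6.c1 d₂ ((1 - αst) * ((1 - α') * ((1 - αst) * r))) α' +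
          A * κ₂ * CG * B6.c1 d₁ ((1 - αst) * r) α') + κ₃) * (geo9K i).len a ^ 4 *
        Real.exp (-((1 - α') * ((1 - αst) * ((1 - α') * ((1 - αst) * r))) * (geo9K i).dist a a'))) := by
  have hSb : 0 ≤ ∑ j, ‖b j‖ := Finset.sum_nonneg fun _ _ => norm_nonneg _
  have hMS : 0 ≤ M₂ * ∑ j, ‖b j‖ := mul_nonneg hM₂ hSb
  have hl9 : ∀ a, 0 ≤ (geo9K i).len a := fun a => (B6KLevelCensusIndexV1.len_pos i a).le
  have hc1a : 0 ≤ B6.c1 d₁ ((1 - αst) * r) α' := c1_nonneg _ _ _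
  have hc1b : 0 ≤ B6.c1 d₂ ((1 - αst) * ((1 - α') * ((1 - αst) * r))) α' := c1_nonneg _ _ _
  set r₁ : ℝ := (1 - α') * ((1 - αst) * r) with hr₁def
  set r₂ : ℝ := (1 - α') * ((1 - αst) * r₁) with hr₂def
  have h1α : 0 ≤ 1 - α' := sub_nonneg.2 hα'1
  have h1s : 0 ≤ 1 - αst := sub_nonneg.2 hαst1
  have hαr : 0 ≤ αst * r := mul_nonneg hαst0 hr0
  have hr' : 0 ≤ (1 - αst) * r := mul_nonneg h1s hr0
  have hr₁0 : 0 ≤ r₁ := mul_nonneg h1α hr'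
  have hr₁r : r₁ ≤ r := by
    have h1 : (1 - αst) * r ≤ r := by nlinarith
    calc r₁ = (1 - α') * ((1 - αst) * r) := hr₁def
      _ ≤ 1 * ((1 - αst) * r) := mul_le_mul_of_nonneg_right (by linarith) hr'
      _ ≤ r := by rw [one_mul]; exact h1
  have hαr₁ : 0 ≤ αst * r₁ := mul_nonneg hαst0 hr₁0
  have hr₁' : 0 ≤ (1 - αst) * r₁ := mul_nonneg h1s hr₁0
  have hr₂0 : 0 ≤ r₂ := mul_nonneg h1α hr₁'
  have hr₂r₁ : r₂ ≤ r₁ := by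
    have h1 : (1 - αst) * r₁ ≤ r₁ := by nlinarith
    calc r₂ = (1 - α') * ((1 - αst) * r₁) := hr₂def
      _ ≤ 1 * ((1 - αst) * r₁) := mul_le_mul_of_nonneg_right (by linarith) hr₁'
      _ ≤ r₁ := by rw [one_mul]; exact h1
  -- the row cut-off as a row-local factor
  have hMl := rowLocal_cutMulY i b ιB hM₂ hrepr χl hχl
  -- (T₁) `M_l·(sO·sO)·S₁`
  have hOO : HasMajorant (g := toB6 (geo9K i) Rr' Hp) (fun p : SiteY i × ι => ιB (blkOf i.D.toDomains p.1))
      (conj b (s • (GpY i (parSymY i) U).restrictScalars ℝ) * conj b (s • (GpY i (parSymY i) U).restrictScalars ℝ))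
      (fun a a' => A * A * CG * B6.c1 d₁ ((1 - αst) * r) α' * ((geo9K i).len a ^ 2 * (geo9K i).len a ^ 2) * Real.exp (-(r₁ * (geo9K i).dist a a'))) :=
    hasMajorant_mul_weighted (g := geo9K i) (R := Rr') (H := Hp) _ d₁ (fun a => (geo9K i).len a ^ 2) (fun a => (geo9K i).len a ^ 2) hA hA hCG
      (fun a => sq_nonneg _) (fun a => sq_nonneg _) hαr hα'0 hα'1 hr' htri hdnn hST h261a hO hO
  have hMlOO : HasMajorant (g := toB6 (geo9K i) Rr' Hp) (fun p : SiteY i × ι => ιB (blkOf i.D.toDomains p.1))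
      (conj b ((cutMulY (𝔸 := 𝔸) χl).restrictScalars ℝ) * (conj b (s • (GpY i (parSymY i) U).restrictScalars ℝ) * conj b (s • (GpY i (parSymY i) U).restrictScalars ℝ)))
      (fun a a' => (1 * (M₂ * ∑ j, ‖b j‖)) * (A * A * CG * B6.c1 d₁ ((1 - αst) * r) α') * ((geo9K i).len a ^ 2 * (geo9K i).len a ^ 2) *
        Real.exp (-(r₁ * (geo9K i).dist a a'))) :=
    hasMajorant_mono (g := toB6 (geo9K i) Rr' Hp) _ (hasMajorant_mul_of_rowLocal (g := toB6 (geo9K i) Rr' Hp)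
      (fun p : SiteY i × ι => ιB (blkOf i.D.toDomains p.1)) (fun _ => 1 * (M₂ * ∑ j, ‖b j‖)) hMl hOO) fun a a' => le_of_eq (by ring)
  have hS₁' : HasMajorant (g := toB6 (geo9K i) Rr' Hp) (fun p : SiteY i × ι => ιB (blkOf i.D.toDomains p.1)) _
      (fun a a' => κ₁ * (1 : ℝ) * Real.exp (-(r₁ * (geo9K i).dist a a'))) :=
    hasMajorant_mono (g := toB6 (geo9K i) Rr' Hp) _ hS₁ fun a a' => by
      rw [mul_one]; exact mul_le_mul_of_nonneg_left (exp_rate_mono hr₁r (hdnn a a')) hκ₁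
  have hSTc : ScaleTransfer (geo9K i) r₁ αst 1 (fun _ => (1 : ℝ)) := fun y y' => by
    rw [mul_one, one_mul]; exact Real.exp_le_one_iff.mpr (by nlinarith [hdnn y y'])
  have hT₁ := hasMajorant_mul_weighted (g := geo9K i) (R := Rr') (H := Hp) (fun p : SiteY i × ι => ιB (blkOf i.D.toDomains p.1)) d₂
    (fun a => (geo9K i).len a ^ 2 * (geo9K i).len a ^ 2) (fun _ => (1 : ℝ)) (mul_nonneg (mul_nonneg zero_le_one hMS) (by positivity)) hκ₁ zero_le_one
    (fun a => by positivity) (fun _ => zero_le_one) hαr₁ hα'0 hα'1 hr₁' htri hdnn hSTc h261b hMlOO hS₁'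
  -- (T₂) `M_l·sO·S₂`
  have hMlO : HasMajorant (g := toB6 (geo9K i) Rr' Hp) (fun p : SiteY i × ι => ιB (blkOf i.D.toDomains p.1))
      (conj b ((cutMulY (𝔸 := 𝔸) χl).restrictScalars ℝ) * conj b (s • (GpY i (parSymY i) U).restrictScalars ℝ))
      (fun a a' => (1 * (M₂ * ∑ j, ‖b j‖)) * A * (geo9K i).len a ^ 2 * Real.exp (-(r * (geo9K i).dist a a'))) :=
    hasMajorant_mono (g := toB6 (geo9K i) Rr' Hp) _ (hasMajorant_mul_of_rowLocal (g := toB6 (geo9K i) Rr' Hp)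
      (fun p : SiteY i × ι => ιB (blkOf i.D.toDomains p.1)) (fun _ => 1 * (M₂ * ∑ j, ‖b j‖)) hMl hO) fun a a' => le_of_eq (by ring)
  have hT₂ := hasMajorant_mul_weighted (g := geo9K i) (R := Rr') (H := Hp) (fun p : SiteY i × ι => ιB (blkOf i.D.toDomains p.1)) d₁
    (fun a => (geo9K i).len a ^ 2) (fun a => (geo9K i).len a ^ 2) (mul_nonneg (mul_nonneg zero_le_one hMS) hA) hκ₂ hCG
    (fun a => sq_nonneg _) (fun a => sq_nonneg _) hαr hα'0 hα'1 hr' htri hdnn hST h261a hMlO hS₂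
  -- the identity and the sum
  rw [locDiff_three_terms i c g U V χl χr s hU hunit hrows hlχ hrχ, B9Cor36GpCubeEntriesAtV.conj_add', B9Cor36GpCubeEntriesAtV.conj_add',
    B9Eq352DivFormLetters.conj_mul, B9Eq352DivFormLetters.conj_mul, B9Eq352DivFormLetters.conj_mul, B9Eq352DivFormLetters.conj_mul,
    B9Eq352DivFormLetters.conj_mul]
  refine hasMajorant_mono (g := toB6 (geo9K i) Rr' Hp) _ (hasMajorant_add (g := toB6 (geo9K i) Rr' Hp) _
    (hasMajorant_add (g := toB6 (geo9K i) Rr' Hp) _ hT₁ hT₂) hS₃) fun a a' => ?_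
  have hd := hdnn a a'
  have hl := hl9 a
  have hl4 : 0 ≤ (geo9K i).len a ^ 4 := pow_nonneg hl 4
  have e4 : (geo9K i).len a ^ 2 * (geo9K i).len a ^ 2 = (geo9K i).len a ^ 4 := by ring
  have hE₁ : Real.exp (-((1 - α') * ((1 - αst) * r₁) * (geo9K i).dist a a')) = Real.exp (-(r₂ * (geo9K i).dist a a')) := by rw [hr₂def]
  have hE₂ : Real.exp (-((1 - α') * ((1 - αst) * r) * (geo9K i).dist a a')) ≤ Real.exp (-(r₂ * (geo9K i).dist a a')) := by
    rw [← hr₁def]; exact exp_rate_mono hr₂r₁ hd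
  have hE₃ : Real.exp (-(r * (geo9K i).dist a a')) ≤ Real.exp (-(r₂ * (geo9K i).dist a a')) := exp_rate_mono (hr₂r₁.trans hr₁r) hd
  have hgoal : Real.exp (-((1 - α') * ((1 - αst) * ((1 - α') * ((1 - αst) * r))) * (geo9K i).dist a a')) = Real.exp (-(r₂ * (geo9K i).dist a a')) := by
    rw [hr₂def, hr₁def]
  rw [hgoal]
  -- term by term
  have hK₁ : 0 ≤ 1 * (M₂ * ∑ j, ‖b j‖) * (A * A * CG * B6.c1 d₁ ((1 - αst) * r) α') * κ₁ * 1 * B6.c1 d₂ ((1 - αst) * r₁) α' := by positivity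
  have hK₂ : 0 ≤ 1 * (M₂ * ∑ j, ‖b j‖) * A * κ₂ * CG * B6.c1 d₁ ((1 - αst) * r) α' := by positivity
  have t1 : 1 * (M₂ * ∑ j, ‖b j‖) * (A * A * CG * B6.c1 d₁ ((1 - αst) * r) α') * κ₁ * 1 * B6.c1 d₂ ((1 - αst) * r₁) α' *
      ((geo9K i).len a ^ 2 * (geo9K i).len a ^ 2 * 1) * Real.exp (-((1 - α') * ((1 - αst) * r₁) * (geo9K i).dist a a')) =
      (M₂ * ∑ j, ‖b j‖) * (A * A * CG * B6.c1 d₁ ((1 - αst) * r) α' * κ₁ * 1 * B6.c1 d₂ ((1 - αst) * ((1 - α') * ((1 - αst) * r))) α') *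
        (geo9K i).len a ^ 4 * Real.exp (-(r₂ * (geo9K i).dist a a')) := by
    rw [hE₁, ← hr₁def]; ring
  have t2 : 1 * (M₂ * ∑ j, ‖b j‖) * A * κ₂ * CG * B6.c1 d₁ ((1 - αst) * r) α' * ((geo9K i).len a ^ 2 * (geo9K i).len a ^ 2) *
      Real.exp (-((1 - α') * ((1 - αst) * r) * (geo9K i).dist a a')) ≤
      (M₂ * ∑ j, ‖b j‖) * (A * κ₂ * CG * B6.c1 d₁ ((1 - αst) * r) α') * (geo9K i).len a ^ 4 * Real.exp (-(r₂ * (geo9K i).dist a a')) := by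
    rw [e4]
    calc 1 * (M₂ * ∑ j, ‖b j‖) * A * κ₂ * CG * B6.c1 d₁ ((1 - αst) * r) α' * (geo9K i).len a ^ 4 *
          Real.exp (-((1 - α') * ((1 - αst) * r) * (geo9K i).dist a a'))
        ≤ 1 * (M₂ * ∑ j, ‖b j‖) * A * κ₂ * CG * B6.c1 d₁ ((1 - αst) * r) α' * (geo9K i).len a ^ 4 * Real.exp (-(r₂ * (geo9K i).dist a a')) :=
          mul_le_mul_of_nonneg_left hE₂ (mul_nonneg hK₂ hl4)
      _ = _ := by ring
  have t3 : κ₃ * (geo9K i).len a ^ 4 * Real.exp (-(r * (geo9K i).dist a a')) ≤ κ₃ * (geo9K i).len a ^ 4 * Real.exp (-(r₂ * (geo9K i).dist a a')) :=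
    mul_le_mul_of_nonneg_left hE₃ (mul_nonneg hκ₃ hl4)
  rw [t1]
  nlinarith [t2, t3]

end Compose

end Literature.MathematicalPhysics.QuantumFieldTheory.Balaban1983to89.B9ThmDLocDiffMajorants

end
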